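import Summits.ResolutionOfSingularities.ResolutionOfSingularities.Theorems.ShadowGameWin.Negative.EveryDimTrap

/-!
# `ShadowGameWin` (crux stmt-ResolutionOfSingularities-16159), negative side — part 5c:
# B wins `SG_p(n)` for EVERY prime `p` and EVERY `n ≥ 2`; the resolver wins iff `n = 1`

From part 5b (`EveryDimTrap.lean`: the three-monomial trap `a_p` in `k + 2` variables is fixed by
every move under B's policy and is not terminal): B simulates A's chart requests (`jsFixN`,
`iFixN`), the play is constant (`play_fixN`), hence never terminal — `shadowGame_lost_dim`
(symbolic prime `p` and `k`), `shadowGame_lost_of_two_le` (every `n ≥ 2`).  Conversely `n = 1` is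
an A-win at stage `0` (`shadowGame_won_one_var`: a non-zero cleaned series in one variable has a
least exponent), so for a prime `p` and `n ≥ 1` the resolver wins `SG_p(n)` iff `n = 1`
(`shadowGame_won_iff`): the crux `ShadowGame.ShadowGameWin` fails at EVERY parameter it was meant
for — `ShadowGameWin_refuted_everyDim : ¬ ShadowGameWin`, a further, independent kernel check of
the refutation of stmt-16159 (first: `Theorems/ShadowGameShadowGameWinRefutation.lean`, `p = 3`,
6-cycle; second: `Negative/EveryPrime.lean`, every `p`, `n = 2`).  Class refuted-misstated:
`Z^p = a_p = u·w^p` with `w = v − uv − u` a regular non-coordinate parameter is uniformised by ONE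
re-parametrisation and ONE division (`Z/w` is a `p`-th root of `u`), which A's alphabet
(coordinate-stratum centres, exceptional-coordinate division, terminal test in B's coordinates)
cannot express; repaired statement C′ = "terminal up to a re-parametrisation fixing the exceptional
hyperplanes" (both witnesses miss it).
Refuter seat refuter-cdisprove-stmt-ResolutionOfSingularities-16159-0, 2026-08-17.
-/

noncomputable section

set_option linter.dupNamespace false

namespace Summit.ResolutionOfSingularities.ResolutionOfSingularities.Theorems.ShadowGameWin.Negative

section Play

variable (p : ℕ) [hp : Fact p.Prime] (k : ℕ)

/-! ## The play never moves -/

/-- B's simulation of A's chart requests (the history of shadows after `m` moves is `m + 1`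
copies of `shadow a_p`). [folklore] -/
def jsFixN (strat : List (Set (Fin (k + 2) → ℚ)) → List (Fin (k + 2)) → Finset (Fin (k + 2))) :
    ℕ → List (Fin (k + 2))
  | 0 => []
  | m + 1 => jsFixN strat m ++
      [chartN k (strat (List.replicate (m + 1) (shadow p (SN p k))) (jsFixN strat m))]

/-- B's chart sequence. [folklore] -/
def iFixN (strat : List (Set (Fin (k + 2) → ℚ)) → List (Fin (k + 2)) → Finset (Fin (k + 2)))
    (m : ℕ) : Fin (k + 2) :=
  chartN k (strat (List.replicate (m + 1) (shadow p (SN p k))) (jsFixN p k strat m))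

/-- The play from `a_p` against B's sequences: the series component is constantly `a_p`.
[folklore] -/
theorem play_fixN
    (strat : List (Set (Fin (k + 2) → ℚ)) → List (Fin (k + 2)) → Finset (Fin (k + 2))) (m : ℕ) :
    play p strat (SN p k) (iFixN p k strat) (fun _ => tauN p k) m =
      (SN p k, List.replicate (m + 1) (shadow p (SN p k)), jsFixN p k strat m) := by
  induction m with
  | zero => rfl
  | succ m ih =>
    rw [play_succ, ih]
    have hstep : step p (strat (List.replicate (m + 1) (shadow p (SN p k))) (jsFixN p k strat m))
        (iFixN p k strat m) ((fun (_ : ℕ) => tauN p k) m) (SN p k) = SN p k :=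
      step_SN p k _
    simp only [hstep]
    rw [List.replicate_succ' (n := m + 1)]
    rfl

/-- MAIN NEGATIVE LEMMA (every prime, every dimension ≥ 2): no strategy of the resolver A wins
the α_p-torsor base-blow-up game `SG_p(k+2)` — the mirrored inner statement of
`ShadowGame.ShadowGameWin` at `(p, n) = (p, k + 2)` is false.  B's play: the three-monomial start
`a_p = u v^p − u^(p+1) v^p − u^(p+1)` over `𝔽_p` (in the first two variables), chart `u` if
allowed (else `v`, else any), translation `v ↦ v + 1` and `0` elsewhere; the state is constant and
never terminal. [folklore] -/
theorem shadowGame_lost_dim :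
    ¬ ∃ strat : List (Set (Fin (k + 2) → ℚ)) → List (Fin (k + 2)) → Finset (Fin (k + 2)),
        (∀ hs js, (strat hs js).Nonempty) ∧
        ∀ (κ : Type) [Field κ] [CharP κ p] [PerfectField κ] (c₀ : (Fin (k + 2) → ℕ) → κ)
          (i : ℕ → Fin (k + 2)) (t : ℕ → Fin (k + 2) → κ),
          (∀ m, i m ∈ strat (play p strat c₀ i t m).2.1 (play p strat c₀ i t m).2.2) →
            ∃ m, (∀ A, clean p (play p strat c₀ i t m).1 A = 0) ∨
              ∃ A, clean p (play p strat c₀ i t m).1 A ≠ 0 ∧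
                (Finset.sum Finset.univ (fun j => A j) ≤ 1 ∨
                  ∀ B, clean p (play p strat c₀ i t m).1 B ≠ 0 → ∀ j, A j ≤ B j) := by
  rintro ⟨strat, hne, hwin⟩
  obtain ⟨m, hm⟩ := hwin (ZMod p) (SN p k) (iFixN p k strat) (fun _ => tauN p k) (fun m => by
    rw [play_fixN p k strat]; exact chartN_mem k _ (hne _ _))
  rw [play_fixN p k strat] at hm
  exact not_terminal_SN p k hm

end Play

/-! ## Every prime, every `n ≥ 2`; and the sharp threshold `n = 1` -/

/-- For every prime `p` and every `n ≥ 2`, B wins `SG_p(n)`: the inner statement of the crux is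
false at `(p, n)`. [folklore] -/
theorem shadowGame_lost_of_two_le (p : ℕ) (hpr : p.Prime) (n : ℕ) (hn : 2 ≤ n) :
    ¬ ∃ strat : List (Set (Fin n → ℚ)) → List (Fin n) → Finset (Fin n),
        (∀ hs js, (strat hs js).Nonempty) ∧
        ∀ (κ : Type) [Field κ] [CharP κ p] [PerfectField κ] (c₀ : (Fin n → ℕ) → κ) (i : ℕ → Fin n)
          (t : ℕ → Fin n → κ),
          (∀ m, i m ∈ strat (play p strat c₀ i t m).2.1 (play p strat c₀ i t m).2.2) →
            ∃ m, (∀ A, clean p (play p strat c₀ i t m).1 A = 0) ∨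
              ∃ A, clean p (play p strat c₀ i t m).1 A ≠ 0 ∧
                (Finset.sum Finset.univ (fun j => A j) ≤ 1 ∨
                  ∀ B, clean p (play p strat c₀ i t m).1 B ≠ 0 → ∀ j, A j ≤ B j) := by
  obtain ⟨k, rfl⟩ : ∃ k, n = k + 2 := ⟨n - 2, by omega⟩
  haveI : Fact p.Prime := ⟨hpr⟩
  exact shadowGame_lost_dim p k

/-- The threshold is sharp: `n = 1` is a (vacuous) A-win at stage `0` — a non-zero cleaned series
in one variable has a least exponent. [folklore] -/
theorem shadowGame_won_one_var (p : ℕ) :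
    ∃ strat : List (Set (Fin 1 → ℚ)) → List (Fin 1) → Finset (Fin 1),
        (∀ hs js, (strat hs js).Nonempty) ∧
        ∀ (κ : Type) [Field κ] [CharP κ p] [PerfectField κ] (c₀ : (Fin 1 → ℕ) → κ) (i : ℕ → Fin 1)
          (t : ℕ → Fin 1 → κ),
          (∀ m, i m ∈ strat (play p strat c₀ i t m).2.1 (play p strat c₀ i t m).2.2) →
            ∃ m, (∀ A, clean p (play p strat c₀ i t m).1 A = 0) ∨
              ∃ A, clean p (play p strat c₀ i t m).1 A ≠ 0 ∧
                (Finset.sum Finset.univ (fun j => A j) ≤ 1 ∨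
                  ∀ B, clean p (play p strat c₀ i t m).1 B ≠ 0 → ∀ j, A j ≤ B j) := by
  refine ⟨fun _ _ => Finset.univ, fun _ _ => ⟨0, Finset.mem_univ _⟩, ?_⟩
  intro κ _ _ _ c₀ i t _
  refine ⟨0, ?_⟩
  show (∀ A, clean p c₀ A = 0) ∨ ∃ A, clean p c₀ A ≠ 0 ∧
    (Finset.sum Finset.univ (fun j => A j) ≤ 1 ∨ ∀ B, clean p c₀ B ≠ 0 → ∀ j, A j ≤ B j)
  by_cases h0 : ∀ A, clean p c₀ A = 0
  · exact Or.inl h0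
  · right
    push Not at h0
    have hfun : ∀ A : Fin 1 → ℕ, A = fun _ => A 0 := fun A =>
      funext fun j => by rw [Subsingleton.elim j 0]
    have hex : ∃ l : ℕ, clean p c₀ (fun _ => l) ≠ 0 := by
      obtain ⟨A, hA⟩ := h0
      exact ⟨A 0, hfun A ▸ hA⟩
    classical
    refine ⟨fun _ => Nat.find hex, Nat.find_spec hex, Or.inr fun B hB j => ?_⟩
    have hB' : clean p c₀ (fun _ => B 0) ≠ 0 := hfun B ▸ hB
    rw [Subsingleton.elim j 0]
    exact Nat.find_min' hex hB'

/-- EXACT FAILURE LOCUS of the crux: for a prime `p` and `n ≥ 1`, the resolver has a winning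
strategy in `SG_p(n)` iff `n = 1`. [folklore] -/
theorem shadowGame_won_iff (p : ℕ) (hpr : p.Prime) (n : ℕ) (hn : 0 < n) :
    (∃ strat : List (Set (Fin n → ℚ)) → List (Fin n) → Finset (Fin n),
        (∀ hs js, (strat hs js).Nonempty) ∧
        ∀ (κ : Type) [Field κ] [CharP κ p] [PerfectField κ] (c₀ : (Fin n → ℕ) → κ) (i : ℕ → Fin n)
          (t : ℕ → Fin n → κ),
          (∀ m, i m ∈ strat (play p strat c₀ i t m).2.1 (play p strat c₀ i t m).2.2) →
            ∃ m, (∀ A, clean p (play p strat c₀ i t m).1 A = 0) ∨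
              ∃ A, clean p (play p strat c₀ i t m).1 A ≠ 0 ∧
                (Finset.sum Finset.univ (fun j => A j) ≤ 1 ∨
                  ∀ B, clean p (play p strat c₀ i t m).1 B ≠ 0 → ∀ j, A j ≤ B j)) ↔ n = 1 := by
  constructor
  · intro h
    by_contra hn1
    exact shadowGame_lost_of_two_le p hpr n (by omega) h
  · rintro rfl
    exact shadowGame_won_one_var p

/-- Refutes `ShadowGame.ShadowGameWin` [refuted-misstated] — third kernel check, via the exact
failure locus `shadowGame_won_iff` (A wins `SG_p(n)` iff `n = 1`), instantiated at
`(p, n) = (2, 3)`. [folklore] -/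
theorem ShadowGameWin_refuted_everyDim :
    ¬ Summit.ResolutionOfSingularities.ResolutionOfSingularities.Theses.ShadowGame.ShadowGameWin :=
  by
  intro h
  have h' : ∀ p : ℕ, p.Prime → ∀ n : ℕ, 0 < n →
      ∃ strat : List (Set (Fin n → ℚ)) → List (Fin n) → Finset (Fin n),
        (∀ hs js, (strat hs js).Nonempty) ∧
        ∀ (κ : Type) [Field κ] [CharP κ p] [PerfectField κ] (c₀ : (Fin n → ℕ) → κ) (i : ℕ → Fin n)
          (t : ℕ → Fin n → κ),
          (∀ m, i m ∈ strat (play p strat c₀ i t m).2.1 (play p strat c₀ i t m).2.2) →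
            ∃ m, (∀ A, clean p (play p strat c₀ i t m).1 A = 0) ∨
              ∃ A, clean p (play p strat c₀ i t m).1 A ≠ 0 ∧
                (Finset.sum Finset.univ (fun j => A j) ≤ 1 ∨
                  ∀ B, clean p (play p strat c₀ i t m).1 B ≠ 0 → ∀ j, A j ≤ B j) := h
  have h31 : (3 : ℕ) = 1 :=
    (shadowGame_won_iff 2 Nat.prime_two 3 (by norm_num)).mp (h' 2 Nat.prime_two 3 (by norm_num))
  exact absurd h31 (by norm_num)

end Summit.ResolutionOfSingularities.ResolutionOfSingularities.Theorems.ShadowGameWin.Negative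

end
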